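import Summits.QuantumFields.BalabanUV.T4Continuum.Support.NE3SlicePoincareSkeleton
import Summits.QuantumFields.BalabanUV.T4Continuum.Support.NE3CovariantSBound
import HarnessLib

/-!
# NE3SlicePoincareRemainderComb (T⁴ programme, node NE3, row K6 of the owner's ruling ρ-g22-2, part K6b-2a of the cut ρ-g23-3 §3) — THE INTERIOR
# COMB-LOOP PAIRING OF THE S-BOUND IN ℓ² CURRENCY: `|Σ_z hsR (ψ z) (combDefect W M η z)| ≤ 2(d−1)(M−1)a·√(card n·d)·√(Σ_z M^d‖ψ z‖²)·√(Σ‖η‖²)`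

NE3 (node U1b) formalisation swarm `b2b-balaban-t4-ne3-formalise-*`, leaf seat `b2b-balaban-t4-ne3-formalise-leaf-02` (gen 6), row **K6**
(assembly of the curved (P♮), booked → leaf-02 lineage; blueprint `HOME/t4/b2b-balaban-t4-ne3-p1/g23/D-ne3p1-g23-1.md` = ruling ρ-g23-3 §2(b), the
COMB term of `R_loop` (the FACE terms are leaf-03-g8's K6-face `NE3CovariantFacePairings`); disprover check D-ne3r2-g8-2 (3):
`16Σ_z‖ψ z‖·2(d−1)(M−1)a·ℓ¹_B(η′) ≤ 32(d−1)(θ∕ε)·y·h`).  Over the owner's K4-c `NE3CovariantBlockDivergence.norm_combDefect_le` (operator-norm ℓ¹ form) and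
K4-d2 `NE3CovariantSBound.abs_hsR_le_nhsNorm` BY NAME; the conversion ℓ¹(op) → ℓ²(nhs) costs `√(card n·d·M^d)` by Cauchy–Schwarz and
`MatrixNorms.opNorm_le_sqrt_card_mul_nhsNorm` — NO bare `M^{1∕2}`: the `M^{d∕2}` is the Jensen weight of the coarse field (`Σ_z M^d·nhsNormSq (ψ z)`
is `≤ Σ‖ζ′‖²` for `ψ = bmeanIterW L k W ζ′` by NE3-R2 g8's (L1) `NE3NestedBlockMeanJensen`, consumed in K6c).  All [folklore], 0 sorry, 0 def:
§1 real helper `sum_le_sqrt_card_mul_sqrt` (`Σ f ≤ √#s·√(Σ f²)`; the Cauchy–Schwarz-with-roots step is inlined — its standalone form already lives in the tree under `Literature.Computability.QuantumComplexity`, not imported here);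
§2 `sum_norm_le_sqrt` (ℓ¹ of operator norms of the `d·M^d` bond values of a block `≤ √(card n·d·M^d)·√(Σ nhsNormSq)`), `norm_combDefect_le_sqrt`;
§3 **`abs_sum_hsR_combDefect_le`** (unitary small-field `W`, `0 ≤ a`, `d, M ≥ 1`, ANY coarse `ψ`, ANY fine `η`):
   `|Σ_{z∈periodBox N} hsR (ψ z) (combDefect W M η z)| ≤ 2((d−1)(M−1)a)·√(card n·d)·√(Σ_{z∈periodBox N} M^d·nhsNormSq (ψ z))·√(Σ_{y∈periodBox(M·N)}Σ_μ nhsNormSq (η y μ))`.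
HONEST FRAMING.  Bookkeeping on OUR lattice objects at ONE unitary background in the small-field class; nothing about Bałaban's minimisers;
(P♮)_W, (ML_w) at `W ≠ 1`, T-E_w and NE3 are NOT proved; spine PROVED 0∕9; finite T⁴ rung (B)+1 — NOT infinite volume, NOT mass gap, NOT
BetaPertH, NOT Clay.  ABSOLUTE RULE kept: no printed sentence is a hypothesis (context only: [Balaban1985Averaging] (120)–(125) pp. 35–36).
PLACEMENT: `Summits/QuantumFields/BalabanUV/`; imports accepted modules only; moves nothing.  HONEST DEPENDENCY: continuum YM on T⁴ ⇐ BetaPertH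
∧ nine spine estimates (0/9 proved); BetaPertH ⇐ (D1) ∧ (D4) ∧ CAP+tail; G-an2-4 gates asym, D1 and NE2/3/4.
-/

set_option autoImplicit false

open scoped BigOperators Matrix.Norms.L2Operator
open Finset

namespace Summit.QuantumFields.BalabanUV.T4Continuum.NE3SlicePoincareRemainderComb

open Literature.MathematicalPhysics.QuantumFieldTheory.Balaban1983to89
open B7Prop1Explicit B7Prop2Explicit MatrixNorms
open T4AveragingDeficitWall (IsUnitaryCfg SmallField Ad)
open T4AveragingDeficitWallBoundary (periodBox mem_periodBox card_periodBox)
open NE3BlockLineAverage (sum_periodBox_blocks)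
open NE3CovariantCalculus (hsR)
open NE3CovariantBlockDivergence (combDefect norm_combDefect_le)
open NE3CovariantSBound (abs_hsR_le_nhsNorm)

noncomputable section

variable {d : ℕ} {n : Type*} [Fintype n] [DecidableEq n]

/-! ## §1 A real Cauchy–Schwarz helper -/

/-- `Σ f ≤ √#s·√(Σ f²)` (Cauchy–Schwarz against the constant `1`, `Finset.sum_mul_sq_le_sq_mul_sq`). [folklore] -/
theorem sum_le_sqrt_card_mul_sqrt {ι : Type*} (s : Finset ι) (f : ι → ℝ) :
    ∑ i ∈ s, f i ≤ Real.sqrt (s.card : ℝ) * Real.sqrt (∑ i ∈ s, f i ^ 2) := by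
  have h := Finset.sum_mul_sq_le_sq_mul_sq s (fun _ => (1 : ℝ)) f
  simp only [one_mul, one_pow, Finset.sum_const, nsmul_eq_mul, mul_one] at h
  calc ∑ i ∈ s, f i ≤ |∑ i ∈ s, f i| := le_abs_self _
    _ = Real.sqrt ((∑ i ∈ s, f i) ^ 2) := (Real.sqrt_sq_eq_abs _).symm
    _ ≤ Real.sqrt ((s.card : ℝ) * ∑ i ∈ s, f i ^ 2) := Real.sqrt_le_sqrt h
    _ = Real.sqrt (s.card : ℝ) * Real.sqrt (∑ i ∈ s, f i ^ 2) := Real.sqrt_mul (Nat.cast_nonneg _) _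

/-! ## §2 The ℓ¹ operator-norm mass of the bond values of a block in ℓ² nhs currency -/

/-- `‖X‖ ≤ √(card n)·√(nhsNormSq X)`. [folklore] -/
theorem opNorm_le_sqrt_card_mul_sqrt (X : Matrix n n ℂ) : ‖X‖ ≤ Real.sqrt (Fintype.card n) * Real.sqrt (nhsNormSq X) := by
  have h := opNorm_le_sqrt_card_mul_nhsNorm X
  unfold nhsNorm at h
  exact h

/-- **ℓ¹(op) → ℓ²(nhs) ON A BLOCK**: `Σ_{v∈periodBox M} Σ_μ ‖η (M•z+v) μ‖ ≤ √(card n·(d·M^d))·√(Σ_v Σ_μ nhsNormSq (η (M•z+v) μ))`. [folklore] -/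
theorem sum_norm_le_sqrt (M : ℕ) (η : Site d → Fin d → Matrix n n ℂ) (z : Site d) :
    ∑ v ∈ periodBox (d := d) M, ∑ μ : Fin d, ‖η ((M : ℤ) • z + v) μ‖
      ≤ Real.sqrt ((Fintype.card n : ℝ) * ((d : ℝ) * (M : ℝ) ^ d))
        * Real.sqrt (∑ v ∈ periodBox (d := d) M, ∑ μ : Fin d, nhsNormSq (η ((M : ℤ) • z + v) μ)) := by
  -- flatten the double sum over `periodBox M ×ˢ univ`
  have hflat : ∀ g : Site d → Fin d → ℝ, ∑ v ∈ periodBox (d := d) M, ∑ μ : Fin d, g v μ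
      = ∑ p ∈ periodBox (d := d) M ×ˢ (Finset.univ : Finset (Fin d)), g p.1 p.2 := fun g => by rw [Finset.sum_product]
  rw [hflat, hflat]
  set s := periodBox (d := d) M ×ˢ (Finset.univ : Finset (Fin d)) with hs
  have hcard : (s.card : ℝ) = (d : ℝ) * (M : ℝ) ^ d := by
    rw [hs, Finset.card_product, card_periodBox, Finset.card_univ, Fintype.card_fin]; push_cast; ring
  -- termwise `‖X‖ ≤ √(card n)·√(nhsNormSq X)`, then Cauchy–Schwarz against the constant `1`
  have h1 : ∑ p ∈ s, ‖η ((M : ℤ) • z + p.1) p.2‖ ≤ ∑ p ∈ s, Real.sqrt (Fintype.card n) * Real.sqrt (nhsNormSq (η ((M : ℤ) • z + p.1) p.2)) :=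
    Finset.sum_le_sum fun p _ => opNorm_le_sqrt_card_mul_sqrt _
  have h2 := sum_le_sqrt_card_mul_sqrt s (fun p => Real.sqrt (nhsNormSq (η ((M : ℤ) • z + p.1) p.2)))
  have h3 : ∑ p ∈ s, Real.sqrt (nhsNormSq (η ((M : ℤ) • z + p.1) p.2)) ^ 2 = ∑ p ∈ s, nhsNormSq (η ((M : ℤ) • z + p.1) p.2) :=
    Finset.sum_congr rfl fun p _ => Real.sq_sqrt (nhsNormSq_nonneg _)
  rw [h3, hcard] at h2
  rw [← Finset.mul_sum] at h1
  have hc : 0 ≤ Real.sqrt (Fintype.card n : ℝ) := Real.sqrt_nonneg _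
  calc ∑ p ∈ s, ‖η ((M : ℤ) • z + p.1) p.2‖
      ≤ Real.sqrt (Fintype.card n) * ∑ p ∈ s, Real.sqrt (nhsNormSq (η ((M : ℤ) • z + p.1) p.2)) := h1
    _ ≤ Real.sqrt (Fintype.card n) * (Real.sqrt ((d : ℝ) * (M : ℝ) ^ d)
        * Real.sqrt (∑ p ∈ s, nhsNormSq (η ((M : ℤ) • z + p.1) p.2))) := mul_le_mul_of_nonneg_left h2 hc
    _ = Real.sqrt ((Fintype.card n : ℝ) * ((d : ℝ) * (M : ℝ) ^ d)) * Real.sqrt (∑ p ∈ s, nhsNormSq (η ((M : ℤ) • z + p.1) p.2)) := by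
        have e : Real.sqrt ((Fintype.card n : ℝ) * ((d : ℝ) * (M : ℝ) ^ d))
            = Real.sqrt (Fintype.card n : ℝ) * Real.sqrt ((d : ℝ) * (M : ℝ) ^ d) := Real.sqrt_mul (Nat.cast_nonneg _) _
        rw [e, mul_assoc]

/-- The comb-loop defect in ℓ² nhs currency (`d, M ≥ 1`): `‖combDefect W M η z‖ ≤ 2((d−1)(M−1)a)·√(card n·d·M^d)·√(Σ_vΣ_μ nhsNormSq (η (M•z+v) μ))`.
[folklore] -/
theorem norm_combDefect_le_sqrt [Nonempty n] (hd : 1 ≤ d) {M : ℕ} (hM : 1 ≤ M) {W : Site d → Fin d → (Matrix n n ℂ)ˣ} (hW : IsUnitaryCfg W)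
    {a : ℝ} (ha : 0 ≤ a) (hWa : SmallField W a) (η : Site d → Fin d → Matrix n n ℂ) (z : Site d) :
    ‖combDefect W M η z‖
      ≤ 2 * (((d : ℝ) - 1) * ((M : ℝ) - 1) * a) * (Real.sqrt ((Fintype.card n : ℝ) * ((d : ℝ) * (M : ℝ) ^ d))
        * Real.sqrt (∑ v ∈ periodBox (d := d) M, ∑ μ : Fin d, nhsNormSq (η ((M : ℤ) • z + v) μ))) := by
  have hd1 : (0 : ℝ) ≤ (d : ℝ) - 1 := by
    have : (1 : ℝ) ≤ d := by exact_mod_cast hd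
    linarith
  have hM1 : (0 : ℝ) ≤ (M : ℝ) - 1 := by
    have : (1 : ℝ) ≤ M := by exact_mod_cast hM
    linarith
  have hc0 : 0 ≤ 2 * (((d : ℝ) - 1) * ((M : ℝ) - 1) * a) := by
    have := mul_nonneg (mul_nonneg hd1 hM1) ha
    linarith
  exact (norm_combDefect_le hW ha hWa η z).trans (mul_le_mul_of_nonneg_left (sum_norm_le_sqrt M η z) hc0)

/-! ## §3 The comb pairing -/

/-- **THE INTERIOR COMB-LOOP PAIRING OF THE S-BOUND** (blueprint ρ-g23-3 §2(b), comb term): for unitary small-field `W` (`0 ≤ a`), `M ≥ 1`,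
ANY coarse 0-form `ψ` and ANY fine direction field `η`,
`|Σ_{z∈periodBox N} hsR (ψ z) (combDefect W M η z)| ≤ 2((d−1)(M−1)a)·√(card n·d)·√(Σ_{z∈periodBox N} M^d·nhsNormSq (ψ z))·√(Σ_{y∈periodBox(M·N)}Σ_μ nhsNormSq (η y μ))`.
[folklore] -/
theorem abs_sum_hsR_combDefect_le [Nonempty n] (hd : 1 ≤ d) {M : ℕ} (hM : 1 ≤ M) (N : ℕ) {W : Site d → Fin d → (Matrix n n ℂ)ˣ}
    (hW : IsUnitaryCfg W) {a : ℝ} (ha : 0 ≤ a) (hWa : SmallField W a) (ψ : Site d → Matrix n n ℂ) (η : Site d → Fin d → Matrix n n ℂ) :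
    |∑ z ∈ periodBox (d := d) N, hsR (ψ z) (combDefect W M η z)|
      ≤ 2 * (((d : ℝ) - 1) * ((M : ℝ) - 1) * a) * Real.sqrt ((Fintype.card n : ℝ) * d)
        * Real.sqrt (∑ z ∈ periodBox (d := d) N, (M : ℝ) ^ d * nhsNormSq (ψ z))
        * Real.sqrt (∑ y ∈ periodBox (d := d) (M * N), ∑ μ : Fin d, nhsNormSq (η y μ)) := by
  set c : ℝ := 2 * (((d : ℝ) - 1) * ((M : ℝ) - 1) * a) with hc
  have hM1 : (0 : ℝ) ≤ (M : ℝ) - 1 := by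
    have : (1 : ℝ) ≤ M := by exact_mod_cast hM
    linarith
  have hd1 : (0 : ℝ) ≤ (d : ℝ) - 1 := by
    have : (1 : ℝ) ≤ d := by exact_mod_cast hd
    linarith
  have hc0 : 0 ≤ c := by
    have := mul_nonneg (mul_nonneg hd1 hM1) ha
    rw [hc]; linarith
  set E : Site d → ℝ := fun z => ∑ v ∈ periodBox (d := d) M, ∑ μ : Fin d, nhsNormSq (η ((M : ℤ) • z + v) μ) with hE
  have hE0 : ∀ z, 0 ≤ E z := fun z => Finset.sum_nonneg fun _ _ => Finset.sum_nonneg fun _ _ => nhsNormSq_nonneg _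
  -- termwise: `|hsR ψ_z C_z| ≤ nhsNorm ψ_z · ‖C_z‖ ≤ c·√(card n·d·M^d)·nhsNorm ψ_z·√E_z = c√(card n d)·(√(M^d nhsNormSq ψ_z))·√E_z`
  have hterm : ∀ z : Site d, |hsR (ψ z) (combDefect W M η z)|
      ≤ c * Real.sqrt ((Fintype.card n : ℝ) * d) * (Real.sqrt ((M : ℝ) ^ d * nhsNormSq (ψ z)) * Real.sqrt (E z)) := by
    intro z
    have h1 := abs_hsR_le_nhsNorm (ψ z) (combDefect W M η z)
    have h2 : nhsNorm (combDefect W M η z) ≤ ‖combDefect W M η z‖ := nhsNorm_le_opNorm _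
    have h3 := norm_combDefect_le_sqrt hd hM hW ha hWa η z
    have hψ0 : 0 ≤ nhsNorm (ψ z) := nhsNorm_nonneg _
    have hsplit : Real.sqrt ((Fintype.card n : ℝ) * ((d : ℝ) * (M : ℝ) ^ d))
        = Real.sqrt ((Fintype.card n : ℝ) * d) * Real.sqrt ((M : ℝ) ^ d) := by
      rw [← Real.sqrt_mul (by positivity), mul_assoc]
    have hψ : nhsNorm (ψ z) * Real.sqrt ((M : ℝ) ^ d) = Real.sqrt ((M : ℝ) ^ d * nhsNormSq (ψ z)) := by
      unfold nhsNorm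
      rw [← Real.sqrt_mul (nhsNormSq_nonneg _), mul_comm]
    calc |hsR (ψ z) (combDefect W M η z)|
        ≤ nhsNorm (ψ z) * ‖combDefect W M η z‖ := h1.trans (mul_le_mul_of_nonneg_left h2 hψ0)
      _ ≤ nhsNorm (ψ z) * (c * (Real.sqrt ((Fintype.card n : ℝ) * ((d : ℝ) * (M : ℝ) ^ d)) * Real.sqrt (E z))) :=
          mul_le_mul_of_nonneg_left h3 hψ0
      _ = c * Real.sqrt ((Fintype.card n : ℝ) * d) * ((nhsNorm (ψ z) * Real.sqrt ((M : ℝ) ^ d)) * Real.sqrt (E z)) := by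
          rw [hsplit]; ring
      _ = _ := by rw [hψ]
  -- sum and Cauchy–Schwarz over the blocks
  have hsum : |∑ z ∈ periodBox (d := d) N, hsR (ψ z) (combDefect W M η z)|
      ≤ c * Real.sqrt ((Fintype.card n : ℝ) * d)
        * ∑ z ∈ periodBox (d := d) N, Real.sqrt ((M : ℝ) ^ d * nhsNormSq (ψ z)) * Real.sqrt (E z) := by
    refine (Finset.abs_sum_le_sum_abs _ _).trans ?_
    rw [Finset.mul_sum]
    exact Finset.sum_le_sum fun z _ => hterm z
  -- Cauchy–Schwarz over the blocks (`Finset.sum_mul_sq_le_sq_mul_sq`, square roots taken by hand)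
  have hCS : ∑ z ∈ periodBox (d := d) N, Real.sqrt ((M : ℝ) ^ d * nhsNormSq (ψ z)) * Real.sqrt (E z)
      ≤ Real.sqrt (∑ z ∈ periodBox (d := d) N, Real.sqrt ((M : ℝ) ^ d * nhsNormSq (ψ z)) ^ 2)
        * Real.sqrt (∑ z ∈ periodBox (d := d) N, Real.sqrt (E z) ^ 2) := by
    have h := Finset.sum_mul_sq_le_sq_mul_sq (periodBox (d := d) N) (fun z => Real.sqrt ((M : ℝ) ^ d * nhsNormSq (ψ z)))
      (fun z => Real.sqrt (E z))
    calc ∑ z ∈ periodBox (d := d) N, Real.sqrt ((M : ℝ) ^ d * nhsNormSq (ψ z)) * Real.sqrt (E z)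
        ≤ |∑ z ∈ periodBox (d := d) N, Real.sqrt ((M : ℝ) ^ d * nhsNormSq (ψ z)) * Real.sqrt (E z)| := le_abs_self _
      _ = Real.sqrt ((∑ z ∈ periodBox (d := d) N, Real.sqrt ((M : ℝ) ^ d * nhsNormSq (ψ z)) * Real.sqrt (E z)) ^ 2) :=
          (Real.sqrt_sq_eq_abs _).symm
      _ ≤ Real.sqrt ((∑ z ∈ periodBox (d := d) N, Real.sqrt ((M : ℝ) ^ d * nhsNormSq (ψ z)) ^ 2)
            * (∑ z ∈ periodBox (d := d) N, Real.sqrt (E z) ^ 2)) := Real.sqrt_le_sqrt h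
      _ = _ := Real.sqrt_mul (Finset.sum_nonneg fun _ _ => sq_nonneg _) _
  have hsq1 : ∑ z ∈ periodBox (d := d) N, Real.sqrt ((M : ℝ) ^ d * nhsNormSq (ψ z)) ^ 2
      = ∑ z ∈ periodBox (d := d) N, (M : ℝ) ^ d * nhsNormSq (ψ z) :=
    Finset.sum_congr rfl fun z _ => Real.sq_sqrt (mul_nonneg (by positivity) (nhsNormSq_nonneg _))
  have hsq2 : ∑ z ∈ periodBox (d := d) N, Real.sqrt (E z) ^ 2 = ∑ y ∈ periodBox (d := d) (M * N), ∑ μ : Fin d, nhsNormSq (η y μ) := by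
    rw [← sum_periodBox_blocks M N hM]
    exact Finset.sum_congr rfl fun z _ => Real.sq_sqrt (hE0 z)
  rw [hsq1, hsq2] at hCS
  have hpre : 0 ≤ c * Real.sqrt ((Fintype.card n : ℝ) * d) := mul_nonneg hc0 (Real.sqrt_nonneg _)
  calc |∑ z ∈ periodBox (d := d) N, hsR (ψ z) (combDefect W M η z)|
      ≤ c * Real.sqrt ((Fintype.card n : ℝ) * d)
        * ∑ z ∈ periodBox (d := d) N, Real.sqrt ((M : ℝ) ^ d * nhsNormSq (ψ z)) * Real.sqrt (E z) := hsum
    _ ≤ c * Real.sqrt ((Fintype.card n : ℝ) * d)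
        * (Real.sqrt (∑ z ∈ periodBox (d := d) N, (M : ℝ) ^ d * nhsNormSq (ψ z))
          * Real.sqrt (∑ y ∈ periodBox (d := d) (M * N), ∑ μ : Fin d, nhsNormSq (η y μ))) := mul_le_mul_of_nonneg_left hCS hpre
    _ = _ := by rw [hc]; ring

end

end Summit.QuantumFields.BalabanUV.T4Continuum.NE3SlicePoincareRemainderComb
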